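import Summits.QuantumAdvantage.QuantumAdvantage.Theses.YangBaxterIslands
import Literature.Computability.Complexity.CircuitLowerBoundsIW

/-!
# Split of the deciding crux `YbTarget` (stmt-QuantumAdvantage-2545) along the DERANDOMIZATION seam

`YbTarget` (∃ L ∈ XXZBQP, L ∉ BPP) ⟸ `YbEHard` ∧ `YbNotP`, glued by the tree's PROVED
Impagliazzo–Wigderson theorem `impagliazzo_wigderson_holds : YbEHard-hypothesis → P = BPP`
(Literature/Computability/Complexity/CircuitLowerBoundsIW.lean, closed discharge of pnp.S24).

* `YbEHard`  — some language in `E = DTIME(2^{O(n)})` needs circuits of size `2^{εn}` at all large `n`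
  (the Impagliazzo–Wigderson hypothesis, verbatim the antecedent of `impagliazzo_wigderson`).
* `YbNotP`   — some language decided by the homogeneous integrable XXZ brickwork family (the class XXZBQP,
  inlined exactly as in the route file) is not in `P` — the thesis `YbTarget` with `BPP` replaced by `P`.
* `YbTarget_of_subs : YbEHard → YbNotP → YbTarget` — the glue (seam = IW97 Thm 2, a theorem, not a tautology).
* necessity / position lemmas: `notP_of_target` (X ⟹ YbNotP: the piece is a CONSEQUENCE of X, via
  `P_subset_BPP_holds`), `notP_of_hardness_of_bqpNotP` (YbHardness ∧ (BQP ⊄ P) ⟹ YbNotP: the foreseen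
  sub-factoring), `bqpNotP_of_summit` (S ⟹ BQP ⊄ P), `summit_of_subs` (route-level: Membership ∧ pieces ⟹ S).
-/

namespace Summit.QuantumAdvantage.QuantumAdvantage.Cruxes.YbTarget.Split

open Summit.QuantumAdvantage.QuantumAdvantage.Theses.YangBaxterIslands

/-- PIECE 1 (crux, hypothesis-type; circuit complexity). `E ⊄ i.o.-SIZE(2^{εn})` in the almost-everywhere
form used by Impagliazzo–Wigderson 1997, Thm. 2: some `L ∈ E` and `ε > 0` with `2^{εn} ≤ circuitSize(L, n)`
for all large `n`. Verbatim the antecedent of `Literature.Computability.Complexity.impagliazzo_wigderson`. -/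
def YbEHard : Prop :=
  ∃ L ∈ Literature.Computability.Complexity.E, ∃ ε : ℝ, 0 < ε ∧ ∀ᶠ n : ℕ in Filter.atTop, (2 : ℝ) ^ (ε * n) ≤ (L.circuitSize n : ℝ)

/-- PIECE 2 (crux; the brickwork beats DETERMINISTIC polynomial time). Some language decided (error ≤ 1/3,
wire 0) by a rational-angle homogeneous integrable XXZ brickwork with an FP input encoding is not in `P`:
`∃ L ∈ XXZBQP, L ∉ P` — the route thesis `YbTarget` with `BPP` replaced by `Classes.P` (class inlined
byte-for-byte as in the route file). -/
def YbNotP : Prop :=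
  ∃ L : Language Bool, (∃ a b : ℚ, ∃ (f : List Bool → List Bool) (p q : Polynomial ℕ), f ∈ Literature.Computability.Complexity.FP ∧ ∃ F : Literature.Computability.Cryptography.QCircuitFamily (⟨Unit, fun _ => 2, fun _ => Matrix.of fun u v : Fin 2 → Bool => if u 0 = u 1 then (if v = u then Complex.exp (-((((b : ℝ) * Real.pi) : ℝ) : ℂ) * Complex.I) else 0) else if v 0 = v 1 then 0 else Complex.exp (((((b : ℝ) * Real.pi) : ℝ) : ℂ) * Complex.I) * (if v = u then ((Real.cos (2 * ((a : ℝ) * Real.pi)) : ℝ) : ℂ) else -(Complex.I * ((Real.sin (2 * ((a : ℝ) * Real.pi)) : ℝ) : ℂ)))⟩ : Literature.Computability.Cryptography.QGateSet), F = ⟨fun n => p.eval n, fun n => ⟨(List.range (q.eval n)).flatMap fun s => (List.range (n + p.eval n)).filterMap fun j => if h : j % 2 = s % 2 ∧ j + 1 < (n + p.eval n) then some (Literature.Computability.Cryptography.QGate.gate () ⟨fun i : Fin 2 => ⟨j + i.val, by have := i.isLt; omega⟩, fun i i' hh => Fin.ext (by simp only [Fin.mk.injEq] at hh; omega)⟩)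 else none⟩⟩ ∧ ∀ x : List Bool, (x ∈ L → (2 : ℝ) / 3 ≤ F.acceptProbOn 0 (f x)) ∧ (x ∉ L → F.acceptProbOn 0 (f x) ≤ 1 / 3)) ∧ L ∉ Literature.Computability.Complexity.Classes.P

/-- Auxiliary (programme-wide, the weakest separation piece): `BQP ⊄ P`, existential form. A CONSEQUENCE
of the summit (`bqpNotP_of_summit`). -/
def BqpNotP : Prop :=
  ∃ L : Language Bool, L ∈ Literature.Computability.Cryptography.BQP ∧ L ∉ Literature.Computability.Complexity.Classes.P

/-- THE GLUE `YbEHard → YbNotP → YbTarget`. Seam = Impagliazzo–Wigderson 1997, Thm. 2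
(`impagliazzo_wigderson_holds`: the circuit lower bound for `E` gives `P = BPP` through worst-case → mild →
strong average-case hardness amplification inside `E` and the quick Nisan–Wigderson generator), after which
`L ∉ P` is `L ∉ BPP`. -/
theorem YbTarget_of_subs (hE : YbEHard) (hX : YbNotP) : YbTarget := by
  -- Impagliazzo–Wigderson: hardness of E derandomises BPP
  have hPBPP : Literature.Computability.Complexity.Classes.P = Literature.Computability.Complexity.BPP :=
    Literature.Computability.Complexity.impagliazzo_wigderson_holds hE
  obtain ⟨L, hL, hLP⟩ := hX
  refine ⟨L, hL, ?_⟩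
  -- the XXZBQP witness outside P is outside BPP
  rw [← hPBPP]
  exact hLP

/-- Necessity of piece 2: `YbTarget → YbNotP` (`P ⊆ BPP`, tree theorem `P_subset_BPP_holds`). -/
theorem notP_of_target (hT : YbTarget) : YbNotP := by
  obtain ⟨L, hL, hLB⟩ := hT
  exact ⟨L, hL, fun hP => hLB (Literature.Computability.Complexity.P_subset_BPP_holds hP)⟩

/-- Foreseen sub-factoring of piece 2 (NOT filed as items: it would idle the Yang–Baxter content for S):
the route's own crux `YbHardness` (BQP ⊆ XXZBQP) and `BQP ⊄ P` give `YbNotP`. -/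
theorem notP_of_hardness_of_bqpNotP (hH : YbHardness) (hB : BqpNotP) : YbNotP := by
  obtain ⟨L, hL, hLP⟩ := hB
  exact ⟨L, hH hL, hLP⟩

/-- `BQP ⊄ P` is a consequence of the summit (strictly weaker: the converse needs `BPP ⊆ P`). -/
theorem bqpNotP_of_summit (hS : _root_.QuantumAdvantage) : BqpNotP := by
  obtain ⟨L, hL, hLB⟩ := hS
  exact ⟨L, hL, fun hP => hLB (Literature.Computability.Complexity.P_subset_BPP_holds hP)⟩

/-- With the route's support `YbMembership` (XXZBQP ⊆ BQP), piece 2 gives `BQP ⊄ P`. -/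
theorem bqpNotP_of_notP (hM : YbMembership) (hX : YbNotP) : BqpNotP := by
  obtain ⟨L, hL, hLP⟩ := hX
  exact ⟨L, hM hL, hLP⟩

/-- Route-level read-back: the two pieces and the route's support `YbMembership` decide the summit
(through the route's own deciding theorem `closes`). -/
theorem summit_of_subs (hM : YbMembership) (hE : YbEHard) (hX : YbNotP) : _root_.QuantumAdvantage :=
  closes hM (YbTarget_of_subs hE hX)


/-! ### Disclosures (position of the pieces relative to X and S; all sorry-free) -/

/-- The seam in one line: piece 1 IS the antecedent of the tree's Impagliazzo–Wigderson theorem. -/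
theorem PeqBPP_of_eHard (hE : YbEHard) :
    Literature.Computability.Complexity.Classes.P = Literature.Computability.Complexity.BPP :=
  Literature.Computability.Complexity.impagliazzo_wigderson_holds hE

/-- DISCLOSURE: modulo derandomization the second piece IS the crux — `P = BPP → (YbTarget ↔ YbNotP)`.
`P = BPP` is not a tree theorem (it is open), so this is not an iff between an item and the crux; it records
exactly what piece 1 pays for. -/
theorem target_iff_notP_of_PeqBPP
    (h : Literature.Computability.Complexity.Classes.P = Literature.Computability.Complexity.BPP) :
    YbTarget ↔ YbNotP := by
  constructor
  · exact notP_of_target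
  · rintro ⟨L, hL, hLP⟩
    exact ⟨L, hL, h ▸ hLP⟩

/-- Hence piece 1 alone reduces the crux to piece 2 and the summit to `BQP ⊄ P`:
`YbEHard → ((YbTarget ↔ YbNotP) ∧ (QuantumAdvantage ↔ BqpNotP))`. -/
theorem reductions_of_eHard (hE : YbEHard) :
    (YbTarget ↔ YbNotP) ∧ (_root_.QuantumAdvantage ↔ BqpNotP) := by
  have h := PeqBPP_of_eHard hE
  refine ⟨target_iff_notP_of_PeqBPP h, ⟨bqpNotP_of_summit, ?_⟩⟩
  rintro ⟨L, hL, hLP⟩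
  exact ⟨L, hL, h ▸ hLP⟩

/-- The generated glue item, exactly as the route file will state it, is closed by `YbTarget_of_subs`. -/
example : YbEHard → YbNotP → YbTarget := fun h₁ h₂ => YbTarget_of_subs h₁ h₂

/-- Sanity: the stub `YbHardness`-signature used in the birth skeleton of `YbNotP` is literally the route decl. -/
example : YbHardness ↔ (Literature.Computability.Cryptography.BQP ⊆ {L : Language Bool | ∃ a b : ℚ, ∃ (f : List Bool → List Bool) (p q : Polynomial ℕ), f ∈ Literature.Computability.Complexity.FP ∧ ∃ F : Literature.Computability.Cryptography.QCircuitFamily (⟨Unit, fun _ => 2, fun _ => Matrix.of fun u v : Fin 2 → Bool => if u 0 = u 1 then (if v = u then Complex.exp (-((((b : ℝ) * Real.pi) : ℝ) : ℂ) * Complex.I) else 0) else if v 0 = v 1 then 0 else Complex.exp (((((b : ℝ) * Real.pi) : ℝ) : ℂ) * Complex.I) * (if v = u then ((Real.cos (2 * ((a : ℝ) * Real.pi)) : ℝ) : ℂ) else -(Complex.I * ((Real.sin (2 * ((a : ℝ) * Real.pi)) : ℝ) : ℂ)))⟩ : Literature.Computability.Cryptography.QGateSet), F = ⟨fun n =>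 p.eval n, fun n => ⟨(List.range (q.eval n)).flatMap fun s => (List.range (n + p.eval n)).filterMap fun j => if h : j % 2 = s % 2 ∧ j + 1 < (n + p.eval n) then some (Literature.Computability.Cryptography.QGate.gate () ⟨fun i : Fin 2 => ⟨j + i.val, by have := i.isLt; omega⟩, fun i i' hh => Fin.ext (by simp only [Fin.mk.injEq] at hh; omega)⟩) else none⟩⟩ ∧ ∀ x : List Bool, (x ∈ L → (2 : ℝ) / 3 ≤ F.acceptProbOn 0 (f x)) ∧ (x ∉ L → F.acceptProbOn 0 (f x) ≤ 1 / 3)}) := Iff.rfl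

end Summit.QuantumAdvantage.QuantumAdvantage.Cruxes.YbTarget.Split
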